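import Mathlib.NumberTheory.Real.Irrational
import Literature.MathematicalPhysics.KineticTheory.HardSphereEuler

/-!
# Negative lemmas for `StrongClosureWeakBV.GeneralStrongClosure` (stmt-AtomisticToContinuum-9395):
# the Vitali witness

Helper lemmas (theorems only; no route decl is mentioned here) for the refutation
`Theorems/StrongClosureWeakBVGeneralStrongClosureRefutation.lean` of the crux at its empty-horizon
corner `T = 0`: a Vitali set `V ⊆ 𝕋³` (transversal of `𝕋³ / ℤ(√2,√2,√2)`: inner measure `0`, outer
measure `> 0`), the vanishing a.e. of a.e.-strongly-measurable fields supported in such a set, the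
vanishing of every momentum target `∫ (χ ρ₀) • (𝟙_V • w)` (a.e. zero when integrable, Bochner junk
otherwise), and smoothness on the empty space–time slab `[a, a) × 𝕋³`.
-/

noncomputable section

open MeasureTheory Set Filter Topology

namespace Summit.AtomisticToContinuum.HydrodynamicLimit.Theorems

open Literature.MathematicalPhysics.KineticTheory Literature.Analysis.FluidPDE

namespace GeneralStrongClosureNegative

/-- **A Vitali set on the flat 3-torus**: a set all of whose measurable subsets are null but which
is not itself null (so it is not null-measurable). Construction: a transversal `V` of
`𝕋³ / ℤ•α`, `α = (√2, √2, √2)` of infinite order; the translates `V + nα` are pairwise disjoint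
(so a measurable `B ⊆ V` has `ℵ₀` disjoint translates of equal measure in a probability space)
and cover `𝕋³` (so `V` cannot be null). [folklore] -/
theorem exists_innerNull_measure_ne_zero_T3 :
    ∃ V : Set T3, (∀ B : Set T3, MeasurableSet B → B ⊆ V → volume B = 0) ∧ volume V ≠ 0 := by
  -- the rotation vector and its infinite order
  set α : T3 := fun _ => ((Real.sqrt 2 : ℝ) : UnitAddCircle) with hαdef
  have hα : ∀ n : ℤ, n • α = 0 → n = 0 := by
    intro n h
    have h0 := congr_fun h 0
    simp only [hαdef, Pi.smul_apply, Pi.zero_apply] at h0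
    rw [← AddCircle.coe_zsmul, AddCircle.coe_eq_zero_iff] at h0
    obtain ⟨k, hk⟩ := h0
    rw [zsmul_eq_mul, zsmul_eq_mul, mul_one] at hk
    by_contra hn
    have hn' : (n : ℝ) ≠ 0 := by exact_mod_cast hn
    refine irrational_sqrt_two.ne_rat (k / n) ?_
    push_cast
    rw [eq_div_iff hn', hk]
    ring
  -- the transversal
  set Q : AddSubgroup T3 := AddSubgroup.zmultiples α with hQ
  set V : Set T3 := Set.range (fun c : T3 ⧸ Q => (c.out : T3)) with hV
  have hcov : ∀ x : T3, ∃ v ∈ V, ∃ n : ℤ, x = v + n • α := by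
    intro x
    obtain ⟨h, hh⟩ := QuotientAddGroup.mk_out_eq_mul Q x
    obtain ⟨n, hn⟩ := AddSubgroup.mem_zmultiples_iff.mp h.2
    refine ⟨((x : T3 ⧸ Q)).out, ⟨_, rfl⟩, -n, ?_⟩
    rw [hh, neg_zsmul, hn]
    abel
  have huniq : ∀ {v₁ v₂ : T3}, v₁ ∈ V → v₂ ∈ V → ∀ {n m : ℤ},
      v₁ + n • α = v₂ + m • α → v₁ = v₂ ∧ n = m := by
    intro v₁ v₂ h₁ h₂ n m h
    obtain ⟨c₁, rfl⟩ := h₁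
    obtain ⟨c₂, rfl⟩ := h₂
    dsimp only at h
    have hc : c₁ = c₂ := by
      rw [← QuotientAddGroup.out_eq' c₁, ← QuotientAddGroup.out_eq' c₂, QuotientAddGroup.eq]
      have h2 : (c₂.out : T3) = c₁.out + n • α - m • α := eq_sub_of_add_eq h.symm
      have h3 : -(c₁.out : T3) + c₂.out = (n - m) • α := by
        rw [h2, sub_zsmul]; abel
      rw [h3]
      exact Q.zsmul_mem (AddSubgroup.mem_zmultiples α) (n - m)
    subst hc
    refine ⟨rfl, ?_⟩
    have h' : n • α = m • α := add_left_cancel h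
    have h0 : (n - m) • α = 0 := by
      rw [sub_zsmul, h']
      abel
    have := hα _ h0
    omega
  have htrans : ∀ (q : T3) (s : Set T3), volume ((fun x => x + q) '' s) = volume s := by
    intro q s
    rw [Set.image_add_right, measure_preimage_add_right]
  refine ⟨V, fun B hB hBV => ?_, fun h0 => ?_⟩
  · -- inner measure zero
    by_contra hne
    set F : ℕ → Set T3 := fun n => (fun x => x + (n : ℤ) • α) '' B with hF
    have hFm : ∀ n, MeasurableSet (F n) := fun n => by
      simp only [hF]
      rw [Set.image_add_right]
      exact measurable_add_const _ hB
    have hdisj : Pairwise (Function.onFun Disjoint F) := by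
      intro i j hij
      rw [Function.onFun, Set.disjoint_left]
      rintro x ⟨b₁, hb₁, rfl⟩ ⟨b₂, hb₂, hx⟩
      have := (huniq (hBV hb₂) (hBV hb₁) hx).2
      exact hij (by exact_mod_cast this.symm)
    have hU : volume (⋃ n, F n) = ∑' n, volume (F n) := measure_iUnion hdisj hFm
    have hconst : ∀ n, volume (F n) = volume B := fun n => htrans _ _
    simp_rw [hconst] at hU
    rw [ENNReal.tsum_const_eq_top_of_ne_zero hne] at hU
    exact (measure_lt_top volume _).ne hU
  · -- positive outer measure
    have hcov' : (Set.univ : Set T3) ⊆ ⋃ n : ℤ, (fun x => x + n • α) '' V := by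
      intro x _
      obtain ⟨v, hv, n, rfl⟩ := hcov x
      exact Set.mem_iUnion.mpr ⟨n, v, hv, rfl⟩
    have huniv : volume (Set.univ : Set T3) = 0 := by
      refine measure_mono_null hcov' ?_
      refine (measure_iUnion_null_iff).mpr fun n => ?_
      rw [htrans]
      exact h0
    simp at huniv

/-- If an a.e.-strongly-measurable field vanishes off a set of inner measure zero, it vanishes
a.e. [folklore] -/
theorem ae_eq_zero_of_innerNull {A : Set T3}
    (hA : ∀ B : Set T3, MeasurableSet B → B ⊆ A → volume B = 0)
    {F : T3 → V3} (hF : AEStronglyMeasurable F volume) (hFA : ∀ x, F x ≠ 0 → x ∈ A) :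
    F =ᵐ[volume] 0 := by
  obtain ⟨F', hF'm, hFF'⟩ := hF
  have hnull : volume {x | F x ≠ F' x} = 0 := ae_iff.mp hFF'
  obtain ⟨Z, hZsub, hZm, hZ0⟩ := exists_measurable_superset_of_null hnull
  have hsupp : MeasurableSet (Function.support F') := hF'm.measurableSet_support
  have h1 : volume (Function.support F' \ Z) = 0 := by
    refine hA _ (hsupp.diff hZm) ?_
    rintro x ⟨hx, hxZ⟩
    apply hFA
    have hxe : F x = F' x := by
      by_contra hne
      exact hxZ (hZsub hne)
    rw [hxe]
    exact hx
  have h2 : volume (Function.support F') = 0 := by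
    have hsub : Function.support F' ⊆ (Function.support F' \ Z) ∪ Z := fun x hx => by
      by_cases hz : x ∈ Z
      · exact Or.inr hz
      · exact Or.inl ⟨hx, hz⟩
    exact measure_mono_null hsub (measure_union_null h1 hZ0)
  have h3 : F' =ᵐ[volume] 0 := by
    refine ae_iff.mpr ?_
    simpa [Function.support] using h2
  exact hFF'.trans h3

/-- `𝟙_A • w` vanishes off `A`. [folklore] -/
theorem mem_of_indicator_smul_ne_zero {A : Set T3} {w : V3} {x : T3}
    (hx : A.indicator (fun _ => (1 : ℝ)) x • w ≠ 0) : x ∈ A := by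
  by_contra h
  exact hx (by simp [Set.indicator_of_notMem h])

/-- The momentum target against the witness velocity `𝟙_A • w` is `0` for every test function
when `A` has inner measure zero: either the integrand is integrable — then it vanishes a.e. — or
the Bochner integral takes its junk value. [folklore] -/
theorem integral_smul_indicator_smul_eq_zero {A : Set T3}
    (hA : ∀ B : Set T3, MeasurableSet B → B ⊆ A → volume B = 0) (w : V3) (χ ρ₀ : T3 → ℝ) :
    ∫ x, (χ x * ρ₀ x) • (A.indicator (fun _ => (1 : ℝ)) x • w) = 0 := by
  by_cases hint : Integrable (fun x => (χ x * ρ₀ x) • (A.indicator (fun _ => (1 : ℝ)) x • w)) volume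
  · refine integral_eq_zero_of_ae (ae_eq_zero_of_innerNull hA hint.aestronglyMeasurable ?_)
    intro x hx
    refine mem_of_indicator_smul_ne_zero (w := w) (fun h => hx ?_)
    rw [h, smul_zero]
  · exact integral_undef hint

/-- At the empty horizon every field is "jointly smooth on `[a, a) × 𝕋³`". [folklore] -/
theorem isSmoothSpaceTimeOn_Ico_self {F : Type*} [NormedAddCommGroup F] [NormedSpace ℝ F]
    (f : ℝ → T3 → F) (a : ℝ) :
    Literature.Analysis.FunctionSpaces.Torus.IsSmoothSpaceTimeOn (Set.Ico a a) f := by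
  unfold Literature.Analysis.FunctionSpaces.Torus.IsSmoothSpaceTimeOn
  rw [Set.Ico_self, Set.empty_prod]
  exact contDiffOn_empty

end GeneralStrongClosureNegative

end Summit.AtomisticToContinuum.HydrodynamicLimit.Theorems

end
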